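import Summits.CriticalPhenomena.Ising3DConformalLimit.Theorems.PerfectScreeningSubharmonicOffOriginOZSubharmonicPrelim
import HarnessLib

/-!
# Ornstein–Zernike ratio asymptotics force eventual strict lattice subharmonicity

Route `PerfectScreening`, crux r2 `SubharmonicOffOrigin` (stmt-CriticalPhenomena-1341), by-product
for the MASSIVE regime (Disproof §(c), STRATEGY-CENSUS §6 D4 / §8.4): the model-free main theorem
(preliminaries in `PerfectScreeningSubharmonicOffOriginOZSubharmonicPrelim.lean`).

Let `ξ : ℝ^d → ℝ` be positively homogeneous of degree one, strictly positive and `C¹` off the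
origin, and let `G, H : ℤ^d → ℝ` with `H > 0` eventually, `H(x + eᵢ)/H(x) → 1` and
`G(x) / (H(x) e^{-ξ(x)}) → 1` as `x → ∞` (Ornstein–Zernike asymptotics in RATIO form).  Then there is
`c > 0` (namely `m²/(4d)`, `m = min_{‖u‖∞=1} ξ(u)`) with `(2d + c)·G(x) ≤ ∑ᵢ (G(x + eᵢ) + G(x − eᵢ))`
for all but finitely many `x` (`eventually_strictSubharmonic_of_ratioAsymptotics`), equivalently
outside a ball (`exists_radius_strictSubharmonic_of_ratioAsymptotics`).  The Ising input enters only
in `PerfectScreeningSubharmonicOffOriginMassiveRegime.lean` (Campanino–Ioffe–Velenik 2003).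
-/

noncomputable section

open Filter Topology Metric Set

namespace Summit.CriticalPhenomena.Ising3DConformalLimit.Theorems.PerfectScreening.OZSubharmonic

variable {d : ℕ}

/-! ### Casting `ℤ^d → ℝ^d` -/

/-- Casting a lattice translate by `+eᵢ` into `ℝ^d`. [folklore] -/
theorem cast_add_single (x : Fin d → ℤ) (i : Fin d) :
    (fun j => ((x + Pi.single i 1 : Fin d → ℤ) j : ℝ)) = (fun j => (x j : ℝ)) + Pi.single i (1 : ℝ) := by
  funext j
  by_cases hj : j = i
  · subst hj; simp
  · simp [hj]

/-- Casting a lattice translate by `−eᵢ` into `ℝ^d`. [folklore] -/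
theorem cast_sub_single (x : Fin d → ℤ) (i : Fin d) :
    (fun j => ((x - Pi.single i 1 : Fin d → ℤ) j : ℝ)) = (fun j => (x j : ℝ)) + -Pi.single i (1 : ℝ) := by
  funext j
  by_cases hj : j = i
  · subst hj; simp [sub_eq_add_neg]
  · simp [hj]

/-- The cast preserves the sup norm. [folklore] -/
theorem norm_cast_eq (x : Fin d → ℤ) : ‖(fun j => (x j : ℝ))‖ = ‖x‖ := by
  apply le_antisymm
  · refine (pi_norm_le_iff_of_nonneg (norm_nonneg _)).2 fun j => ?_
    rw [Int.norm_cast_real]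
    exact norm_le_pi_norm x j
  · refine (pi_norm_le_iff_of_nonneg (norm_nonneg _)).2 fun j => ?_
    rw [← Int.norm_cast_real]
    exact norm_le_pi_norm (fun j => (x j : ℝ)) j

/-- On `ℤ^d` the sup norm of the cast tends to `∞` along the cofinite filter. [folklore] -/
theorem tendsto_norm_cast_cofinite :
    Tendsto (fun x : Fin d → ℤ => ‖(fun j => (x j : ℝ))‖) cofinite atTop := by
  have h1 : Tendsto (fun x : Fin d → ℤ => ‖x‖) cofinite atTop := by
    rw [← cocompact_eq_cofinite]
    exact tendsto_norm_cocompact_atTop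
  exact h1.congr fun x => (norm_cast_eq x).symm

/-- A cofinite eventuality on `ℤ^d` holds outside a sup-norm ball. [folklore] -/
theorem exists_radius_of_eventually {P : (Fin d → ℤ) → Prop} (h : ∀ᶠ x in cofinite, P x) :
    ∃ R : ℝ, ∀ x : Fin d → ℤ, R < ‖x‖ → P x := by
  rw [eventually_cofinite] at h
  obtain ⟨R, hR⟩ := (h.image fun x => ‖x‖).bddAbove
  refine ⟨R, fun x hx => ?_⟩
  by_contra hP
  have hle : ‖x‖ ≤ R := hR (Set.mem_image_of_mem (fun x => ‖x‖) hP)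
  linarith

/-! ### Main theorem -/

/-- Per-site exponent bookkeeping: from the two linearisation bounds at `q` (with `‖q‖ ≥ 1`) the
partial derivatives `aᵢ = ∂ᵢξ(q̂)` satisfy `∑|aᵢ| ≥ m` and `ξ(q ± eᵢ) ≤ ξ(q) ± aᵢ + ε`. [folklore] -/
theorem exponent_bounds {ξ : (Fin d → ℝ) → ℝ}
    (hhom : ∀ c : ℝ, 0 < c → ∀ x, ξ (c • x) = c * ξ x)
    (hdiff : ∀ y : Fin d → ℝ, y ≠ 0 → DifferentiableAt ℝ ξ y)
    {m : ℝ} (hmle : ∀ u : Fin d → ℝ, ‖u‖ = 1 → m ≤ ξ u)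
    {q : Fin d → ℝ} (hq : 1 ≤ ‖q‖) {ε : ℝ}
    (h3p : ∀ i : Fin d, |ξ (q + Pi.single i 1) - ξ q -
      fderiv ℝ ξ (‖q‖⁻¹ • q) (Pi.single i 1)| ≤ ε)
    (h3m : ∀ i : Fin d, |ξ (q + -Pi.single i 1) - ξ q -
      fderiv ℝ ξ (‖q‖⁻¹ • q) (-Pi.single i 1)| ≤ ε) :
    ∃ a : Fin d → ℝ, m ≤ ∑ i : Fin d, |a i| ∧
      (∀ i : Fin d, ξ (q + Pi.single i 1) ≤ ξ q + a i + ε) ∧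
      (∀ i : Fin d, ξ (q + -Pi.single i 1) ≤ ξ q - a i + ε) := by
  have hqpos : 0 < ‖q‖ := by linarith
  have hu : ‖(‖q‖⁻¹ • q : Fin d → ℝ)‖ = 1 := by
    rw [norm_smul, norm_inv, norm_norm, inv_mul_cancel₀ hqpos.ne']
  have hu0 : (‖q‖⁻¹ • q : Fin d → ℝ) ≠ 0 := by
    intro h
    rw [h, norm_zero] at hu
    exact zero_ne_one hu
  refine ⟨fun i => fderiv ℝ ξ (‖q‖⁻¹ • q) (Pi.single i 1), ?_, fun i => ?_, fun i => ?_⟩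
  · exact le_trans (hmle _ hu) (self_le_sum_abs_partial hhom hu (hdiff _ hu0))
  · have h := (abs_le.1 (h3p i)).2
    linarith
  · have h := (abs_le.1 (h3m i)).2
    rw [map_neg] at h
    linarith

/-- **Ornstein–Zernike ratio asymptotics force eventual uniformly strict lattice subharmonicity.**
Let `ξ : ℝ^d → ℝ` be positively `1`-homogeneous, strictly positive and `C¹` off the origin; let
`H : ℤ^d → ℝ` be eventually positive with `H(x + eᵢ)/H(x) → 1` for each `i`, and let
`G(x)/(H(x) e^{-ξ(x)}) → 1` as `x → ∞` in `ℤ^d`.  Then there is `c > 0` such that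
`(2d + c)·G(x) ≤ ∑ᵢ (G(x + eᵢ) + G(x − eᵢ))` for all but finitely many `x` — one may take
`c = m²/(4d)` with `m = min_{‖u‖∞ = 1} ξ(u)`. [folklore] -/
theorem eventually_strictSubharmonic_of_ratioAsymptotics (hd : 0 < d)
    {ξ : (Fin d → ℝ) → ℝ} (hhom : ∀ c : ℝ, 0 < c → ∀ x, ξ (c • x) = c * ξ x)
    (hpos : ∀ x, x ≠ 0 → 0 < ξ x) (hC1 : ContDiffOn ℝ 1 ξ {0}ᶜ)
    {G H : (Fin d → ℤ) → ℝ} (hH : ∀ᶠ x in cofinite, 0 < H x)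
    (hratio : ∀ i : Fin d, Tendsto (fun x => H (x + Pi.single i 1) / H x) cofinite (𝓝 1))
    (hasymp : Tendsto (fun x => G x / (H x * Real.exp (-ξ (fun j => (x j : ℝ)))))
      cofinite (𝓝 1)) :
    ∃ c : ℝ, 0 < c ∧ ∀ᶠ x in cofinite,
      (2 * d + c) * G x ≤ ∑ i : Fin d, (G (x + Pi.single i 1) + G (x - Pi.single i 1)) := by
  have hO : IsOpen (({0} : Set (Fin d → ℝ))ᶜ) := isOpen_compl_singleton
  have hdiff : ∀ y : Fin d → ℝ, y ≠ 0 → DifferentiableAt ℝ ξ y := fun y hy =>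
    (hC1.differentiableOn one_ne_zero y hy).differentiableAt (hO.mem_nhds hy)
  -- Step 1: the positive minimum `m` of `ξ` on the unit sphere
  obtain ⟨m, hm, hmle⟩ : ∃ m : ℝ, 0 < m ∧ ∀ u : Fin d → ℝ, ‖u‖ = 1 → m ≤ ξ u := by
    have hS : IsCompact (sphere (0 : Fin d → ℝ) 1) := isCompact_sphere 0 1
    have hS0 : sphere (0 : Fin d → ℝ) 1 ⊆ {0}ᶜ := by
      intro u hu h0
      rw [mem_sphere_zero_iff_norm] at hu
      have h0' : u = 0 := h0
      rw [h0', norm_zero] at hu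
      exact zero_ne_one hu
    have hcont : ContinuousOn ξ (sphere 0 1) := hC1.continuousOn.mono hS0
    by_cases hne : (sphere (0 : Fin d → ℝ) 1).Nonempty
    · obtain ⟨u₀, hu₀, hmin⟩ := hS.exists_isMinOn hne hcont
      refine ⟨ξ u₀, hpos u₀ (hS0 hu₀), fun u hu => ?_⟩
      exact isMinOn_iff.1 hmin u (mem_sphere_zero_iff_norm.2 hu)
    · exact ⟨1, one_pos, fun u hu => (hne ⟨u, mem_sphere_zero_iff_norm.2 hu⟩).elim⟩
  -- Step 2: the constants
  have hdpos : (0 : ℝ) < d := by exact_mod_cast hd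
  obtain ⟨c, hc_def⟩ : ∃ c : ℝ, c = m ^ 2 / (4 * d) := ⟨_, rfl⟩
  have hc : 0 < c := by rw [hc_def]; positivity
  obtain ⟨ε, hε_def⟩ : ∃ ε : ℝ, ε = c / (8 * d + 8 * c) := ⟨_, rfl⟩
  have hε : 0 < ε := by rw [hε_def]; positivity
  have hεeq : ε * (8 * d + 8 * c) = c := by
    rw [hε_def]; field_simp
  have hε1 : ε < 1 := by
    rw [hε_def, div_lt_one (by positivity)]; nlinarith
  refine ⟨c, hc, ?_⟩
  -- Step 3: the eventual facts
  -- (E1) two-sided OZ bounds and positivity of `H`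
  have hE1 : ∀ᶠ y in cofinite, 0 < H y ∧
      (1 - ε) * (H y * Real.exp (-ξ (fun j => (y j : ℝ)))) ≤ G y ∧
      G y ≤ (1 + ε) * (H y * Real.exp (-ξ (fun j => (y j : ℝ)))) := by
    have h1 := Metric.tendsto_nhds.1 hasymp ε hε
    filter_upwards [hH, h1] with y hy hdist
    have hden : 0 < H y * Real.exp (-ξ (fun j => (y j : ℝ))) := mul_pos hy (Real.exp_pos _)
    rw [Real.dist_eq, abs_sub_lt_iff] at hdist
    obtain ⟨hlt1, hlt2⟩ := hdist
    refine ⟨hy, ?_, ?_⟩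
    · have h2 : 1 - ε < G y / (H y * Real.exp (-ξ (fun j => (y j : ℝ)))) := by linarith
      exact ((lt_div_iff₀ hden).1 h2).le
    · have h2 : G y / (H y * Real.exp (-ξ (fun j => (y j : ℝ)))) < 1 + ε := by linarith
      exact ((div_lt_iff₀ hden).1 h2).le
  -- shifts by `± eᵢ` are cofinite-to-cofinite
  have hsp : ∀ i : Fin d, Tendsto (fun x : Fin d → ℤ => x + Pi.single i 1) cofinite cofinite := by
    intro i
    have h : Function.Injective (fun x : Fin d → ℤ => x + Pi.single i 1) := add_left_injective _
    exact h.tendsto_cofinite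
  have hsm : ∀ i : Fin d, Tendsto (fun x : Fin d → ℤ => x - Pi.single i 1) cofinite cofinite := by
    intro i
    have h : Function.Injective (fun x : Fin d → ℤ => x - Pi.single i 1) := sub_left_injective
    exact h.tendsto_cofinite
  have hE1p : ∀ i : Fin d, ∀ᶠ x : Fin d → ℤ in cofinite,
      (1 - ε) * (H (x + Pi.single i 1) *
        Real.exp (-ξ ((fun j => (x j : ℝ)) + Pi.single i 1))) ≤ G (x + Pi.single i 1) := by
    intro i
    refine ((hsp i).eventually hE1).mono fun x hx => ?_
    have h := hx.2.1
    rwa [cast_add_single x i] at h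
  have hE1m : ∀ i : Fin d, ∀ᶠ x : Fin d → ℤ in cofinite,
      (1 - ε) * (H (x - Pi.single i 1) *
        Real.exp (-ξ ((fun j => (x j : ℝ)) + -Pi.single i 1))) ≤ G (x - Pi.single i 1) := by
    intro i
    refine ((hsm i).eventually hE1).mono fun x hx => ?_
    have h := hx.2.1
    rwa [cast_sub_single x i] at h
  -- (E2) prefactor ratios
  have hE2p : ∀ i : Fin d, ∀ᶠ x in cofinite, (1 - ε) * H x ≤ H (x + Pi.single i 1) := by
    intro i
    have h1 := Metric.tendsto_nhds.1 (hratio i) ε hε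
    filter_upwards [hH, h1] with x hx hdist
    rw [Real.dist_eq, abs_sub_lt_iff] at hdist
    have h2 : 1 - ε < H (x + Pi.single i 1) / H x := by linarith [hdist.2]
    exact ((lt_div_iff₀ hx).1 h2).le
  have hE2m : ∀ i : Fin d, ∀ᶠ x in cofinite, (1 - ε) * H x ≤ H (x - Pi.single i 1) := by
    intro i
    have h1 := Metric.tendsto_nhds.1 (hratio i) ε hε
    have hQ : ∀ᶠ y in cofinite, 0 < H y ∧ H (y + Pi.single i 1) ≤ (1 + ε) * H y := by
      filter_upwards [hH, h1] with y hy hdist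
      rw [Real.dist_eq, abs_sub_lt_iff] at hdist
      have h2 : H (y + Pi.single i 1) / H y < 1 + ε := by linarith [hdist.1]
      exact ⟨hy, ((div_lt_iff₀ hy).1 h2).le⟩
    filter_upwards [(hsm i).eventually hQ] with x hx
    obtain ⟨hpos', hle⟩ := hx
    rw [sub_add_cancel] at hle
    have h3 : (1 - ε) * H x ≤ (1 - ε) * ((1 + ε) * H (x - Pi.single i 1)) :=
      mul_le_mul_of_nonneg_left hle (by linarith)
    have h4 : 0 ≤ ε ^ 2 * H (x - Pi.single i 1) := by positivity
    nlinarith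
  -- (E3) linearised exponents, once `‖x‖` exceeds the linearisation radii
  have hnorm := tendsto_norm_cast_cofinite (d := d)
  have hE3p : ∀ i : Fin d, ∀ᶠ x : Fin d → ℤ in cofinite,
      |ξ ((fun j => (x j : ℝ)) + Pi.single i 1) - ξ (fun j => (x j : ℝ)) -
        fderiv ℝ ξ (‖(fun j => (x j : ℝ))‖⁻¹ • (fun j => (x j : ℝ))) (Pi.single i 1)| ≤ ε := by
    intro i
    obtain ⟨R, -, hRle⟩ := linearisation hhom hC1 (Pi.single i (1 : ℝ)) hε
    filter_upwards [hnorm.eventually_ge_atTop R] with x hx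
    exact hRle _ hx
  have hE3m : ∀ i : Fin d, ∀ᶠ x : Fin d → ℤ in cofinite,
      |ξ ((fun j => (x j : ℝ)) + -Pi.single i 1) - ξ (fun j => (x j : ℝ)) -
        fderiv ℝ ξ (‖(fun j => (x j : ℝ))‖⁻¹ • (fun j => (x j : ℝ))) (-Pi.single i 1)| ≤ ε := by
    intro i
    obtain ⟨R, -, hRle⟩ := linearisation hhom hC1 (-Pi.single i (1 : ℝ)) hε
    filter_upwards [hnorm.eventually_ge_atTop R] with x hx
    exact hRle _ hx
  have hE0 : ∀ᶠ x : Fin d → ℤ in cofinite, 1 ≤ ‖(fun j => (x j : ℝ))‖ :=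
    hnorm.eventually_ge_atTop 1
  -- Step 4: combine pointwise
  filter_upwards [hE1, hE0, eventually_all.2 hE2p, eventually_all.2 hE2m, eventually_all.2 hE1p,
    eventually_all.2 hE1m, eventually_all.2 hE3p, eventually_all.2 hE3m]
    with x h1 h0 h2p h2m h1p h1m h3p h3m
  obtain ⟨a, ha, hap, ham⟩ := exponent_bounds hhom hdiff hmle h0 h3p h3m
  exact stencil_chain hd (Gp := fun i => G (x + Pi.single i 1)) (Gm := fun i => G (x - Pi.single i 1))
    (Hp := fun i => H (x + Pi.single i 1)) (Hm := fun i => H (x - Pi.single i 1))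
    (ξp := fun i => ξ ((fun j => (x j : ℝ)) + Pi.single i 1))
    (ξm := fun i => ξ ((fun j => (x j : ℝ)) + -Pi.single i 1))
    hm hc_def hεeq h1.1 h1.2.2 h1p h1m h2p h2m hap ham ha

/-- **Radius form.** Under the hypotheses of
`eventually_strictSubharmonic_of_ratioAsymptotics` there are `c > 0` and `R` with
`(2d + c)·G(x) ≤ ∑ᵢ (G(x + eᵢ) + G(x − eᵢ))` for all `x` with `‖x‖ > R`. [folklore] -/
theorem exists_radius_strictSubharmonic_of_ratioAsymptotics (hd : 0 < d)
    {ξ : (Fin d → ℝ) → ℝ} (hhom : ∀ c : ℝ, 0 < c → ∀ x, ξ (c • x) = c * ξ x)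
    (hpos : ∀ x, x ≠ 0 → 0 < ξ x) (hC1 : ContDiffOn ℝ 1 ξ {0}ᶜ)
    {G H : (Fin d → ℤ) → ℝ} (hH : ∀ᶠ x in cofinite, 0 < H x)
    (hratio : ∀ i : Fin d, Tendsto (fun x => H (x + Pi.single i 1) / H x) cofinite (𝓝 1))
    (hasymp : Tendsto (fun x => G x / (H x * Real.exp (-ξ (fun j => (x j : ℝ)))))
      cofinite (𝓝 1)) :
    ∃ c : ℝ, 0 < c ∧ ∃ R : ℝ, ∀ x : Fin d → ℤ, R < ‖x‖ →
      (2 * d + c) * G x ≤ ∑ i : Fin d, (G (x + Pi.single i 1) + G (x - Pi.single i 1)) := by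
  obtain ⟨c, hc, hev⟩ :=
    eventually_strictSubharmonic_of_ratioAsymptotics hd hhom hpos hC1 hH hratio hasymp
  exact ⟨c, hc, exists_radius_of_eventually hev⟩

/-- One-line form (registered sub-goal of stmt-CriticalPhenomena-1341): Ornstein–Zernike ratio
asymptotics with a positively homogeneous `C¹` rate function force eventual uniformly strict lattice
subharmonicity outside a ball. [folklore] -/
theorem exists_radius_strictSubharmonic_of_ratioAsymptotics' : ∀ {d : ℕ}, 0 < d → ∀ {ξ : (Fin d → ℝ) → ℝ}, (∀ c : ℝ, 0 < c → ∀ x, ξ (c • x) = c * ξ x) → (∀ x, x ≠ 0 → 0 < ξ x) → ContDiffOn ℝ 1 ξ {0}ᶜ → ∀ {G H : (Fin d → ℤ) → ℝ}, (∀ᶠ x in cofinite, 0 < H x) → (∀ i : Fin d, Tendsto (fun x => H (x + Pi.single i 1) / H x) cofinite (𝓝 1)) → Tendsto (fun x => G x / (H x * Real.exp (-ξ (fun j => (x j : ℝ))))) cofinite (𝓝 1) → ∃ c : ℝ, 0 < c ∧ ∃ R : ℝ, ∀ x : Fin d → ℤ, R < ‖x‖ → (2 * d + c) * G x ≤ ∑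 i : Fin d, (G (x + Pi.single i 1) + G (x - Pi.single i 1)) :=
  fun hd _ hhom hpos hC1 _ _ hH hratio hasymp =>
    exists_radius_strictSubharmonic_of_ratioAsymptotics hd hhom hpos hC1 hH hratio hasymp

end Summit.CriticalPhenomena.Ising3DConformalLimit.Theorems.PerfectScreening.OZSubharmonic
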